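/-
Origin: expansion seat `planner-pub-hodgecm-pohl-g15-0`, handover #6 2026-08-18T16:19:39Z (md5 c42ced96bed7da9716e78dbdc56f1a43, 312 l.; RUN-32 CANDIDATE ROW, ON REQUEST ONLY — TREE-SHAPE SPLIT (≤400 l.) of the pohl lineage, source lines verbatim; REPLACES HodgeCM/Model/KillH0.lean in place (module name kept ⇒ no importer edits); lands AFTER KillH0Transform; rewrites import Pohl15.KillH0Transform -> HodgeCM.Model.KillH0Transform x1) (`HOME/pub-hodgecm-pohl-g15/lean/Pohl15/KillH0.lean`, md5 c42ced96, 312 lines);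
landed by the packager successor (mc-unitary-1-g3, gen-8 kit) in gate run 32 REPLACES the earlier landed copy of `HodgeCM/Model/KillH0.lean` (import ^import Pohl15\.KillH0Transform[ \t]*$→import HodgeCM.Model.KillH0Transform ×1).
-/
/-
Copyright: pub-hodgecm formalisation cell (harness21, 2026). New file (not vendored).
Origin: HOME/pub-hodgecm-pohl-g15/lean/Pohl15/KillH0.lean — session planner-pub-hodgecm-pohl-g15-0 (unit pub-hodgecm-pohl-g15),
EXPANSION part (b) `PohlmannSpan`, generation 15: TREE-SHAPE STAGING under the 400-line rule of lean/CONVENTIONS.md §2 — part 2/2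
of the split of `HodgeCM/Model/KillH0.lean` (pohl-g7, gate run 25; 516 l., md5 56272adb25be): source lines 274–516 VERBATIM; the module docstring below is the source's, with one `Layout` sentence appended.
Intended final place: `HodgeCM/Model/KillH0.lean` (module `HodgeCM.Model.KillH0`); WIP import `Pohl15.KillH0Transform` → `HodgeCM.Model.KillH0Transform` on landing.  The LAST part keeps the old module name, so no importer changes.
-/
import Summits.HodgeConjecture.HodgeCM.Model.KillH0Transform

/-!
# Killing `H⁰`: a universe transform preserving the model axioms

For a universe `U` (the signature `HodgeCM.Universe` of `HodgeCM.Geometry.Universe`) we define the universe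
`U♭ := U.killH0` with the SAME varieties, morphisms, dimensions, products, CM abelian varieties, CM actions and Picard
modular surfaces, and with

* `H⁰(X) := 0` (carrier `PUnit`) and `H^k(X)` UNCHANGED for `k ≥ 1` — definitionally: `U♭.Coh X (k+1)` reduces to
  `U.Coh X (k+1)` with the same `ℚ`-module structure, so that every statement of the theory that lives in FIXED positive
  degrees (`1`, `2`, `4`: eigen-lines, Weil lines, Künneth, `H¹`-rank, `H⁴`-span, `cup_comm1`, Lefschetz (1,1), …) holds in
  `U♭` by the very same proof term (`exact M.foo`);
* in degree `0`: the zero Hodge structure (`zeroHodgeStructure`, all `F^p = ⊤` on the zero space), `alg X 0 := ⊥`,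
  `pull f 0 := 0`, every cup product with a degree-`0` factor `:= 0`, `tr X 0 := 0`.

A comparison map `KillH0.toU X k : U♭.Coh X k →ₗ[ℚ] U.Coh X k` (`0` in degree `0`, the identity otherwise) is INJECTIVE IN
EVERY DEGREE and commutes with `pull`, `cup`, `tr`, `castCoh`, scalar action, and detects `alg` (`mem_alg_iff`); statements
with VARIABLE degrees (M2, M3, F4, F5, F7d, block pairs, diagonal actions, …) transfer through it.

## Results

* §0 the zero Hodge structure; §1 the transform; §2 its API (`toU`, `ofU`, `toU_injective`, `toU_pull`, `toU_cup`, `tr_eq`,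
  `mem_alg_iff`, `toU_castCoh`);
* §3 transports: `cupPow_eq`, `isFactorAct_iff`, `isDiagAct_of_killH0`, `isBlockPair_of_killH0` (the last two read the
  degree-`0` component of a `U♭`-commutation relation, which is vacuous, as the `U`-relation — this needs M2 and `H0Rigid` in `U`);
* §4 **`KillH0.modelAxioms (M : U.ModelAxioms) (h0 : U.H0Rigid) (htr : U.TrZero) (hd : U.Fact_dimProd) : U♭.ModelAxioms`**
  — all 28 fields.  The three extra hypotheses on the SOURCE universe: `H0Rigid` (all morphisms `X → Y` act alike on `H⁰`;
  true in the intended model — connected varieties — and in the exterior toy universe; used for M27 `deg_diag` / M28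
  `algDuality`, whose diagonal CM actions are commutation relations in all degrees incl. `0`), `TrZero` (all traces vanish;
  exterior toy universe; used for M26 `gysin_surface` only — the Gysin class of a surface `X → S` with `dim X = 2` lives in
  `H⁰(X)` and is killed, so M26 survives only where traces carry no information), `Fact_dimProd` (used for M28 only: with M11
  it gives `dim (A₀ × A₁ × A₂ × A₃) = 4·(half-degree) ≥ 4`, so the duality degree `2(dim P − 2)` is positive);
* §5 transfers of N1 `Fact_cupExterior`, N2 `Fact_cup_hodge`, N4 `Fact_hodge_F0`, F4 `Fact_cupAlg`, F5 `Fact_cupAssoc`,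
  `Fact_dimProd` (`Iff`), the realisation input `RealisationExistsFace`, `TrZero`; N3 `Fact_pull_H0` and `H0Rigid` hold in
  `U♭` UNCONDITIONALLY; and `KillH0.finrank_coh_zero : dim_ℚ H⁰(X) = 0` for every `X`.

Downstream: `HodgeCM.Model.KillH0Descent` (F7d `Fact_gysinDescent` transfers; `Fact_H0_rank`, `CMProdH0Nontrivial`,
`CMProdConnected`, F6 `Fact_weightDual`, `PohlmannTheorem31All` FAIL in `U♭`) and `HodgeCM.Model.Toy.KillH0` (the instance
`toyModel.killH0` and the INDEPENDENCE THEOREM `degreeZero_independent`: the degree-`0` input of the all-`p` Pohlmann theorem is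
not a consequence of `ModelAxioms` + N1–N4 + F4 + F5 + F7d + `Fact_dimProd`).

No print meaning is claimed for `U♭` (it is not the cohomology of anything: `H⁰` of a point is `ℚ`); it is a consistency /
independence device for the axiom system, like the exterior toy universe itself.  KERNEL-PROVED throughout (Lean + Mathlib
axioms only); nothing is cited; no hypothesis is named after PerL / [QW8] / the 2001 programme.

Layout (2026-08-18, tree 400-line rule): §§0–3 (the transform `killH0`, its comparison maps and transport lemmas; former first half of this file) are now `KillH0Transform.lean`, imported here; all statements verbatim.
-/

noncomputable section

open scoped TensorProduct

namespace HodgeCM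

open Literature.AlgebraicGeometry.Motives (CMType HodgeStructure)
open Literature.AlgebraicGeometry.Motives.HodgeStructure (EndAction ofRat complexConj)

namespace Universe

variable (U : Universe)

/-- **All morphisms `X → Y` act alike on `H⁰`** (in the intended model: `X`, `Y` are connected, `H⁰ = ℚ` is the constants
and `f^*` of a constant function is the same constant — Hatcher, *Algebraic Topology* Prop. 2.7 / §3.1, as for N3).  With M1
it implies N3 `Fact_pull_H0` (`pull_H0_of_h0Rigid`).  Used here ONLY as a hypothesis on the source universe of the transform
(discharged by a kernel proof for the exterior toy universe in `HodgeCM.Model.Toy.KillH0`), never as a cited fact. -/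
def H0Rigid : Prop := ∀ (X Y : U.Var) (f g : U.Mor X Y), U.pull f 0 = U.pull g 0

/-- **All traces vanish** (true in the exterior toy universe, `tr := 0`; false in the intended model).  A hypothesis on
the source universe of the transform only. -/
def TrZero : Prop := ∀ (X : U.Var) (k : ℕ), U.tr X k = 0

variable {U}

/-- (Ported verbatim from the HodgeCMPerL package; no docstring in the source.) -/
theorem pull_H0_of_h0Rigid (h1 : U.Fact_pull_id) (h : U.H0Rigid) : U.Fact_pull_H0 := fun X f =>
  (h X X f (U.idMor X)).trans (h1 X 0)

namespace KillH0

set_option smartUnfolding false in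
/-- (Ported verbatim from the HodgeCMPerL package; no docstring in the source.) -/
theorem isDiagAct_of_killH0 (h2 : U.Fact_pull_comp) (h0 : U.H0Rigid) {K : CMField} {Φ : Fin 4 → CMType K} {a : K}
    {M : U.Mor (U.prod4 K Φ) (U.prod4 K Φ)} (h : U.killH0.IsDiagAct K Φ a M) : U.IsDiagAct K Φ a M := by
  obtain ⟨e, he1, he2⟩ := h
  refine ⟨e, he1, fun i k => ?_⟩
  cases k with
  | zero => rw [← h2, ← h2]; exact h0 _ _ _ _
  | succ k => exact he2 i (k + 1)

set_option smartUnfolding false in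
/-- (Ported verbatim from the HodgeCMPerL package; no docstring in the source.) -/
theorem isBlockPair_of_killH0 (h2 : U.Fact_pull_comp) (h0 : U.H0Rigid) {F : CMField} {n m : ℕ}
    {Ξ : Fin (n + 1 + (m + 1)) → CMType F} {pA : U.Mor (U.cmProd F Ξ) (U.cmProd F (blkA Ξ))}
    {pB : U.Mor (U.cmProd F Ξ) (U.cmProd F (blkB Ξ))} (h : U.killH0.IsBlockPair F Ξ pA pB) :
    U.IsBlockPair F Ξ pA pB := by
  obtain ⟨hA, hB⟩ := h
  refine ⟨fun j k => ?_, fun i k => ?_⟩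
  · cases k with
    | zero => exact (h2 _ _ _ pA (U.prj n (fun j => U.cmAV F (blkA Ξ j)) j) 0).symm.trans (h0 _ _ _ _)
    | succ k => exact hA j (k + 1)
  · cases k with
    | zero => exact (h2 _ _ _ pB (U.prj m (fun i => U.cmAV F (blkB Ξ i)) i) 0).symm.trans (h0 _ _ _ _)
    | succ k => exact hB i (k + 1)

/-! ## 4. `killH0` preserves the model axioms -/

/-- (Ported verbatim from the HodgeCMPerL package; no docstring in the source.) -/
theorem dim_prod4 (M : U.ModelAxioms) (hd : U.Fact_dimProd) (K : CMField) (Φ : Fin 4 → CMType K) :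
    U.dim (U.prod4 K Φ) = 4 * K.halfDegree := by
  have hd' : ∀ X Y : U.Var, U.dim (U.prod X Y) = U.dim X + U.dim Y := hd
  have hc : ∀ Ψ : CMType K, U.dim (U.cmAV K Ψ) = K.halfDegree := fun Ψ => (M.cmAV K Ψ).2.2
  show U.dim (U.prod (U.prod (U.prod _ _) _) _) = _
  rw [hd', hd', hd', hc, hc, hc, hc]
  ring

omit U in
/-- (Ported verbatim from the HodgeCMPerL package; no docstring in the source.) -/
theorem one_le_halfDegree (K : CMField) : 1 ≤ K.halfDegree := by
  have h2 := two_mul_halfDegree K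
  have hpos : 0 < Module.finrank ℚ K := Module.finrank_pos
  omega

set_option smartUnfolding false in
/-- **`U♭` is a model whenever `U` is** — given that in `U` all morphisms act alike on `H⁰` (`H0Rigid`), all traces vanish
(`TrZero`; needed for M26 only) and `dim (X × Y) = dim X + dim Y` (`Fact_dimProd`; needed for M28 only, to know
`dim P ≥ 3` for the corner products). -/
theorem modelAxioms (M : U.ModelAxioms) (h0 : U.H0Rigid) (htr : U.TrZero) (hd : U.Fact_dimProd) :
    U.killH0.ModelAxioms where
  pull_id X k := by
    cases k with
    | zero => exact LinearMap.ext fun x => Subsingleton.elim _ _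
    | succ k => exact M.pull_id X (k + 1)
  pull_comp X Y Z f g k := by
    cases k with
    | zero => exact LinearMap.ext fun x => Subsingleton.elim _ _
    | succ k => exact M.pull_comp X Y Z f g (k + 1)
  pull_cup X Y f i j x y := by
    apply toU_injective
    rw [toU_pull, toU_cup, toU_cup, toU_pull, toU_pull]
    exact M.pull_cup X Y f i j _ _
  pull_hodge X Y f k p := by
    cases k with
    | zero =>
      haveI := (Submodule.subsingleton_iff ℂ).mpr (subsingleton_cohC_zero (U := U) X)
      exact le_of_eq (Subsingleton.elim _ _)
    | succ k => exact M.pull_hodge X Y f (k + 1) p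
  cup2_hodge X k p q x y hx hy := by
    cases k with
    | zero =>
      have h : U.killH0.cup2C X 0 x y = 0 := Subsingleton.elim _ _
      rw [h]
      exact Submodule.zero_mem _
    | succ k => exact M.cup2_hodge X (k + 1) p q x y hx hy
  tr_degree X k hk := by
    cases k with
    | zero => rfl
    | succ k => exact M.tr_degree X (k + 1) hk
  alg_le_hodge X p := by
    cases p with
    | zero => exact bot_le
    | succ p => exact M.alg_le_hodge X (p + 1)
  pull_alg X Y f p := by
    rintro _ ⟨y, hy, rfl⟩
    rw [mem_alg_iff, toU_pull]
    exact M.pull_alg X Y f p ⟨_, (mem_alg_iff (U := U) Y p y).mp hy, rfl⟩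
  cup_alg X x y hx hy := M.cup_alg X x y hx hy
  lefschetz11 X := M.lefschetz11 X
  cmAV := M.cmAV
  eigenLine := M.eigenLine
  alphaLine := M.alphaLine
  cmDominated X hX := by
    obtain ⟨F, hG, h6, n, Θ, s, π, N, hN, h⟩ := M.cmDominated X hX
    refine ⟨F, hG, h6, n, Θ, s, π, N, hN, fun k => ?_⟩
    cases k with
    | zero => exact LinearMap.ext fun x => Subsingleton.elim _ _
    | succ k => exact h (k + 1)
  weilLine_rank := M.weilLine_rank
  weilLine_hodge := M.weilLine_hodge
  pms_dim := M.pms_dim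
  lift := M.lift
  cup_comm1 := M.cup_comm1
  cup_interchange := M.cup_interchange
  kunneth1 := M.kunneth1
  H1_rank := M.H1_rank
  H4_span := M.H4_span
  cmEnd := M.cmEnd
  conjIsogeny := M.conjIsogeny
  gysin_surface S X f hS :=
    ⟨0, Submodule.zero_mem _, fun y => by
      rw [map_zero (U.killH0.cup X 4 (2 * (U.killH0.dim X - 2)) y), map_zero (U.killH0.tr X _), tr_eq, htr]
      rfl⟩
  deg_diag K Φ a Ma hMa k := by
    have h := M.deg_diag K Φ a Ma (isDiagAct_of_killH0 M.pull_comp h0 hMa) k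
    ext x
    have hx := LinearMap.congr_fun h (toU (U.prod4 K Φ) k x)
    simp only [LinearMap.comp_apply, LinearMap.smul_apply] at hx
    rw [LinearMap.comp_apply, LinearMap.smul_apply, tr_eq, toU_pull, tr_eq]
    exact hx
  algDuality K Φ := by
    obtain ⟨D, hD1, hD2, hD3⟩ := M.algDuality K Φ
    have hK := one_le_halfDegree K
    have hP := dim_prod4 M hd K Φ
    have hdim : 2 * (U.dim (U.prod4 K Φ) - 2) ≠ 0 := by omega
    refine ⟨ofU _ 4 ∘ₗ D ∘ₗ toU _ (2 * (U.dim (U.prod4 K Φ) - 2)), ?_, ?_, ?_⟩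
    · exact (ofU_bijective _ (by norm_num)).comp (hD1.comp (toU_bijective _ hdim))
    · rintro _ ⟨x, hx, rfl⟩
      rw [SetLike.mem_coe, mem_alg_iff] at hx
      exact hD2 ⟨_, hx, rfl⟩
    · intro a Ma Mb hMa hMb
      have h := hD3 a Ma Mb (isDiagAct_of_killH0 M.pull_comp h0 hMa) (isDiagAct_of_killH0 M.pull_comp h0 hMb)
      ext x
      have hx := LinearMap.congr_fun h (toU (U.prod4 K Φ) (2 * (U.dim (U.prod4 K Φ) - 2)) x)
      simp only [LinearMap.comp_apply, LinearMap.smul_apply] at hx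
      rw [LinearMap.comp_apply, LinearMap.comp_apply, LinearMap.comp_apply, LinearMap.smul_apply,
        LinearMap.comp_apply, LinearMap.comp_apply, toU_pull]
      exact hx

/-! ## 5. `killH0` preserves N1–N4, F4, F5, `Fact_dimProd` and the realisation input — and kills `H⁰` -/

/-- (Ported verbatim from the HodgeCMPerL package; no docstring in the source.) -/
theorem cupExterior_iff (X : U.Var) (k : ℕ) : U.killH0.CupExterior X k ↔ U.CupExterior X k := by
  constructor
  · rintro ⟨e, hb, he⟩
    exact ⟨e, hb, fun a => (he a).trans (cupPow_eq (U := U) X k a)⟩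
  · rintro ⟨e, hb, he⟩
    exact ⟨e, hb, fun a => (he a).trans (cupPow_eq (U := U) X k a).symm⟩

set_option smartUnfolding false in
/-- The CM products of `U♭` are those of `U` (definitionally; recorded as an equation of varieties so that statements
about them can be rewritten without unfolding the recursion `prodFin`). -/
theorem cmProd_eq {F : CMField} {n : ℕ} (Θ : Fin (n + 1) → CMType F) : U.killH0.cmProd F Θ = U.cmProd F Θ := rfl

/-- N1 `Fact_cupExterior` transfers (all its degrees are `≥ 1`). -/
theorem fact_cupExterior (h : U.Fact_cupExterior) : U.killH0.Fact_cupExterior := by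
  intro F n Θ k
  rw [cupExterior_iff, cmProd_eq]
  exact h F n Θ k

/-- N2 `Fact_cup_hodge` transfers (degree `0` factors: the cup is `0`). -/
theorem fact_cup_hodge (h : U.Fact_cup_hodge) : U.killH0.Fact_cup_hodge := by
  intro X i j p q x y hx hy
  cases i with
  | zero =>
    have h0 : U.killH0.cupC X 0 j x y = 0 := by
      rw [Subsingleton.elim x 0, map_zero (U.killH0.cupC X 0 j), LinearMap.zero_apply]
    rw [h0]
    exact Submodule.zero_mem _
  | succ i =>
    cases j with
    | zero =>
      have h0 : U.killH0.cupC X (i + 1) 0 x y = 0 := by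
        rw [Subsingleton.elim y 0, map_zero (U.killH0.cupC X (i + 1) 0 x)]
      rw [h0]
      exact Submodule.zero_mem _
    | succ j => exact h X (i + 1) (j + 1) p q x y hx hy

/-- N3 `Fact_pull_H0` holds in `U♭` UNCONDITIONALLY (`H⁰ = 0`). -/
theorem fact_pull_H0 : U.killH0.Fact_pull_H0 := fun _ _ => LinearMap.ext fun _ => Subsingleton.elim _ _

/-- `H0Rigid` holds in `U♭` unconditionally. -/
theorem h0Rigid : U.killH0.H0Rigid := fun _ _ _ _ => LinearMap.ext fun _ => Subsingleton.elim _ _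

/-- `TrZero` transfers. -/
theorem trZero (h : U.TrZero) : U.killH0.TrZero := by
  intro X k
  cases k with
  | zero => rfl
  | succ k => exact h X (k + 1)

/-- N4 `Fact_hodge_F0` transfers (`F⁰` of the zero Hodge structure is `⊤` by definition). -/
theorem fact_hodge_F0 (h : U.Fact_hodge_F0) : U.killH0.Fact_hodge_F0 := by
  intro X k
  cases k with
  | zero => rfl
  | succ k => exact h X (k + 1)

/-- F4 `Fact_cupAlg` transfers. -/
theorem fact_cupAlg (h : U.Fact_cupAlg) : U.killH0.Fact_cupAlg := by
  intro X p q x y hx hy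
  rw [mem_alg_iff, toU_castCoh, toU_cup]
  exact h X p q _ _ ((mem_alg_iff (U := U) X p x).mp hx) ((mem_alg_iff (U := U) X q y).mp hy)

/-- F5 `Fact_cupAssoc` transfers. -/
theorem fact_cupAssoc (h : U.Fact_cupAssoc) : U.killH0.Fact_cupAssoc := by
  intro X i j k a b c
  apply toU_injective
  rw [toU_cup, toU_cup, toU_castCoh, toU_cup, toU_cup]
  exact h X i j k _ _ _

/-- `Fact_dimProd` is a statement about `dim` and `prod` only. -/
theorem fact_dimProd_iff : U.killH0.Fact_dimProd ↔ U.Fact_dimProd := Iff.rfl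

/-- **`dim H⁰(X) = 0` for every variety of `U♭`** (so `CMProdConnected`, `Fact_H0_rank`, `CMProdH0Nontrivial` all FAIL
in `U♭`: `HodgeCM.Model.KillH0Descent`). -/
theorem finrank_coh_zero (X : U.Var) : Module.finrank ℚ (U.killH0.Coh X 0) = 0 :=
  Module.finrank_zero_of_subsingleton

/-- The realisation input `RealisationExistsFace` (theta one-forms: degrees `1` and `4` only) transfers verbatim. -/
theorem realisationExistsFace (h : U.RealisationExistsFace) : U.killH0.RealisationExistsFace := by
  intro F hG h6 f ι₁ hf V
  obtain ⟨r⟩ := h F hG h6 f ι₁ hf V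
  exact ⟨{ r with }⟩

end KillH0

end Universe

end HodgeCM

end
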